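import Literature.MathematicalPhysics.QuantumFieldTheory.Balaban1983to89.T3SectALandauChart
import HarnessLib

/-!
# Route `UnitScaleTilt`, crux K1 child «MinimiserStabilityRegPr» (stmt-QuantumFields-19200), registered stub `stub_prop7From14` (skeleton birth_v7
# cc37a178…; leaf V3) — THE OWNER'S v8 PILLAR **P-V3-CDE** (`Prop5Printed ∧ Prop6Printed (famLG3 L S) ∧ ∀ i, ExistenceLeavesCap (bridgeFam3 L S i)`,
# CARD-19200-V3-g8 §3) UNFOLDED MEMBER BY MEMBER AT THE T³ OBJECTS, FOR EVERY PRESENTATION `S` — the exact native texts the pen quantifies,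
# and the located ε-bookkeeping of the leaf `axial18` at the T³ bridge

Cell `ym3-torus`, width seat `ym-ust-19200-w2` (gen 0; D-0149 / director l-ym3-bs R350 (A′); OWNER W-SEAT START LIST 2026-08-27 22:29Z: «w2 = P-V3-CDE:
Prop5Printed ∧ Prop6Printed at S_print … first file = the Prop 5 statement over S_print letters»).  YM₃ on T³ is a ladder rung (R3), not the Clay problem;
nothing here is a claim about the crux or the mass gap.

WHY.  `Prop7PillarsPrint.prop7From14At_of_pillars_print` (p572062) glues V3 from P-V3-A (`Prop2Printed`) and P-V3-CDE at print's based presentation; the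
P-V3-A side has its native form `T3SectALandauChart.prop2Printed_famLG3_iff_native`.  THIS FILE gives the P-V3-CDE side the same service: [Balaban1985Variational]
Proposition 5 (p. 294), Proposition 6 (p. 295) and the three located existence leaves of pp. 296–299 (`B11Prop7Assembly.ExistenceLeavesCap`: (112) ↦ critical in
(19)–(21); p. 299 «Proposition 7 [6] implies that U_k belongs to the space (18)»; (141)–(142) minimality) READ AT `famLG3 L S` ∕ `bridgeFam3 L S`, with the
carrier's bodies displayed ((14) = `RegPr ∧ CloseAvg`, (19) = `In19`, (15)–(16) = `emb15`/`act16` = the gauge action, (2)/(3)/criticality/minimality of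
`T3Thm1Carrier.varProblem3` = `RegPr` ∕ `∈ fibre` ∕ `IsCritR2` ∕ `IsMinOn` over `regFibrePr`) and the presentation's letters (`AvgCond`, `IsLandau`, `CritL`,
`nMax`, `Sol111`, `T112`, `LikeH1B`, `Sol111G`, `SolAnalytic`, `Restricted`) left BY NAME — so that whichever bodies the v8 pen's `S_print` gives the Sect. C–E
letters (seat w2) on top of the Sect. A letters (seat w1), the three conjuncts of P-V3-CDE are these T³ statements.

WHAT IS PROVED (sorry-free, no definition; pure unfolding).
§1 `prop5Printed_famLG3_iff` — Prop. 5 at the presented family, native.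
§2 `prop6Printed_famLG3_iff` — Prop. 6 at the presented family, native (all three printed clauses).
§3 `crit112_bridgeFam3_iff`, `axial18_bridgeFam3_iff`, `minimal142_bridgeFam3_iff` (one leaf each, `(U₁U₀)^u` written as the gauge action on `U₁U₀`),
   `existenceLeavesCap_bridgeFam3_iff`, `existenceLeavesCap_bridgeFam3_of_native`.

LOCATED (for the owner's pen; count-neutral).  Read at the T³ bridge, the leaf `axial18` concludes `RegPr (O₂·ε₂) ((U₁U₀)^u)` for EVERY `ε₂` admitted by
`In19_21 ε₂` (§3 displays it): with honest letters, `U₁ = 1`, `X = 0` over a CURVED background `U₀ ∈ fibre V` that is critical in reading R2 satisfies (19) for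
every `ε₂ > 0` (`T3SectALandauChart.in19_one_zero`) and (20)/(21)/«critical in (19)–(21)» with `u = 1`, so the conclusion would put `U₀` in `𝔘_k(O₂ε₂)` for
`ε₂ → 0`.  Print (p. 299) and the knit (`B11Prop7Assembly.exists_minimalOrbit_of_prop6_cap(_explicit)`) use the leaf ONLY at `ε₂ = O₁C₁B₃ε₁ ≥ C₁B₃ε₁`
(«U_k belongs to the space (18) with ε₀ = O(1)C₁B₃ε₁»); the regime form `C₁B₃ε₁ ≤ ε₂ → …` is what a T³ proof can deliver (sibling file of this seat).

HONEST SCOPE.  Unfoldings only: Props 5, 6 and the leaves remain HYPOTHESIS SCHEMAS (typed statements of record at the presented family); nothing of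
[Balaban1985Variational] is proved here.  Count-neutral helper toward stmt-QuantumFields-19200 (`--supports`), not a proof of the stub.

References: T. Bałaban, CMP 102 (1985) 277–309 [Balaban1985Variational] ((14)–(21) pp.279–281, Prop. 5 (104), (111)–(112) p.294, Prop. 6 (115) p.295, p.296
after (122), (123)–(142) pp.296–299); CMP 99 (1985) 75–102 [Balaban1985RegularSpaces] ((1.29) p.81, Prop. 7 p.98).
-/

noncomputable section

namespace Summit.QuantumFields.YangMills.Theorems.Prop7PV3CDENative

open Literature.MathematicalPhysics.QuantumFieldTheory.Balaban1983to89
open Literature.MathematicalPhysics.QuantumFieldTheory.Balaban1983to89.T3ContinuumYM3Torus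
open Literature.MathematicalPhysics.QuantumFieldTheory.Balaban1983to89.T3UnitLawDensityEML (ℰp)
open Literature.MathematicalPhysics.QuantumFieldTheory.Balaban1983to89.T3DescentFibreTower
open Literature.MathematicalPhysics.QuantumFieldTheory.Balaban1983to89.T3ConstrainedMinimiser
open Literature.MathematicalPhysics.QuantumFieldTheory.Balaban1983to89.T3TiltDescent
open Literature.MathematicalPhysics.QuantumFieldTheory.Balaban1983to89.T3PrintedRegularMinimiser
open Literature.MathematicalPhysics.QuantumFieldTheory.Balaban1983to89.T3PrintedRegularOrbits (descTransf)
open B11 (VarProblemX LGData Prop5Printed Prop6Printed)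
open B11Prop7Assembly (Bridge ExistenceLeavesCap)
open T3Thm1Carrier
open T3Thm1CarrierNative (IsCritR2)
open T3SectALandauChart

open scoped Matrix.Norms.L2Operator

variable {L : ℕ}

/-! ## §1 Proposition 5 at the presented family, native -/

/-- **[Balaban1985Variational] PROPOSITION 5 AT THE PRESENTED T³ FAMILY, NATIVE FORM** (pure unfolding of `B11.Prop5Printed B₁ B₃ C₁ (famLG3 L S)`):
print, p. 294: *«All critical configurations U₁ of the functional A(U₁U₀) in the space defined by (19)–(21), U₀ satisfies (14), can be obtained from solutions
of Eq. (111) in the space (104) by the transformation U₁ = exp iη[A₁ + H₁B − HD(A₁ + H₁B)]. (112)»*.  At member `i = (F, n, K)`: for `0 < ε₁`, `B₃ε₁ ≤ ε₀`,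
`B₁(ε₀ + C₁ε₁) ≤ ε₂ ≤ ε₃/4`, `ε₃ ≤ c`, every datum `V`, every background `U₀` with (14) = `RegPr (C₁B₃ε₁) U₀ ∧ CloseAvg (C₁ε₁) V U₀`, every `U₁` with an
exponent `X` in (19) (`In19 ε₂ U₀ U₁ X`), (20) (`AvgCond`), (21) (`IsLandau`) which is «critical in (19)–(21)» (`CritL`): some `A₁` with `nMax U₀ A₁ < 2ε₃`
((104)) solves (111) (`Sol111`) and `T112 V U₀ A₁ = U₁` ((112)). [cite: Balaban1985Variational, Prop. 5 (104), (111)-(112) p.294; (14)-(21) pp.279-281] -/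
theorem prop5Printed_famLG3_iff {S : ResidFam L} {B₁ B₃ C₁ : ℝ} :
    Prop5Printed B₁ B₃ C₁ (famLG3 L S) ↔
      ∃ c : ℝ, 0 < c ∧ ∀ (i : Idx L) (ε₀ ε₁ ε₂ ε₃ : ℝ), 0 < ε₁ → B₃ * ε₁ ≤ ε₀ → B₁ * (ε₀ + C₁ * ε₁) ≤ ε₂ → ε₂ ≤ ε₃ / 4 → ε₃ ≤ c →
        ∀ (V : GaugeField (i.1.1.P i.1.2.1) 0 (Matrix.specialUnitaryGroup (Fin 2) ℂ))
          (U₀ : GaugeField (i.1.1.P i.1.2.2) 0 (Matrix.specialUnitaryGroup (Fin 2) ℂ)),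
          RegPr i.1.1 i.1.2.1 i.1.2.2 (C₁ * B₃ * ε₁) U₀ → CloseAvg i.1.1 i.1.2.1 i.1.2.2 i.2.2.le (C₁ * ε₁) V U₀ →
          ∀ (U₁ : GaugeField (i.1.1.P i.1.2.2) 0 (Matrix.specialUnitaryGroup (Fin 2) ℂ))
            (X : PBond (i.1.1.P i.1.2.2) 0 → Matrix (Fin 2) (Fin 2) ℂ),
            In19 i.1.1 i.1.2.1 i.1.2.2 ε₂ U₀ U₁ X → (S i).AvgCond V U₀ X → (S i).IsLandau U₀ X → (S i).CritL V U₀ U₁ →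
              ∃ A₁ : PBond (i.1.1.P i.1.2.2) 0 → Matrix (Fin 2) (Fin 2) ℂ,
                (S i).nMax U₀ A₁ < 2 * ε₃ ∧ (S i).Sol111 V U₀ A₁ ∧ (S i).T112 V U₀ A₁ = U₁ := by
  constructor
  · rintro ⟨c, hc, H⟩
    refine ⟨c, hc, fun i ε₀ ε₁ ε₂ ε₃ hε₁ hB₃ε hε₂ hε₂₃ hε₃ V U₀ hreg hclose U₁ X h19 h20 h21 hcrit => ?_⟩
    exact H i ε₀ ε₁ ε₂ ε₃ hε₁ hB₃ε hε₂ hε₂₃ hε₃ V U₀ ⟨hreg, hclose⟩ U₁ ⟨X, h19, h20, h21⟩ hcrit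
  · rintro ⟨c, hc, H⟩
    refine ⟨c, hc, fun i ε₀ ε₁ ε₂ ε₃ hε₁ hB₃ε hε₂ hε₂₃ hε₃ V U₀ h14 U₁ h1921 hcrit => ?_⟩
    obtain ⟨hreg, hclose⟩ := h14
    obtain ⟨X, h19, h20, h21⟩ := h1921
    exact H i ε₀ ε₁ ε₂ ε₃ hε₁ hB₃ε hε₂ hε₂₃ hε₃ V U₀ hreg hclose U₁ X h19 h20 h21 hcrit

/-! ## §2 Proposition 6 at the presented family, native -/

/-- **[Balaban1985Variational] PROPOSITION 6 AT THE PRESENTED T³ FAMILY, NATIVE FORM** (pure unfolding of `B11.Prop6Printed B₀ B₃ C₁ (famLG3 L S)`): print,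
p. 295: *«There exists a positive, absolute constant a₄ such, that for ε₄ ≦ a₄ and ε₁ satisfying 2B₀C₁B₃ε₁ ≦ ε₄ Eq. (111) has exactly one solution in the space
(115). This solution satisfies the bounds (115) with ε₄ = 3B₀C₁B₃ε₁. Moreover, if we replace the configuration H₁B by an arbitrary configuration 𝔄 with values in
the complexified Lie algebra, and satisfying the same bounds as H₁B, then the above statement is again true and the solution is an analytic function of 𝔄.»*  At
member `i`: the background's (14) is `RegPr (C₁B₃ε₁) U₀ ∧ CloseAvg (C₁ε₁) V U₀`; (115), (111), «the same bounds as H₁B», «(111) with 𝔄», «analytic» are the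
presentation's `nMax`, `Sol111`, `LikeH1B`, `Sol111G`, `SolAnalytic`. [cite: Balaban1985Variational, Prop. 6 (115) p.295; (14) p.280] -/
theorem prop6Printed_famLG3_iff {S : ResidFam L} {B₀ B₃ C₁ : ℝ} :
    Prop6Printed B₀ B₃ C₁ (famLG3 L S) ↔
      ∃ a₄ : ℝ, 0 < a₄ ∧ ∀ (i : Idx L) (ε₁ ε₄ : ℝ), 0 < ε₁ → ε₄ ≤ a₄ → 2 * B₀ * C₁ * B₃ * ε₁ ≤ ε₄ →
        ∀ (V : GaugeField (i.1.1.P i.1.2.1) 0 (Matrix.specialUnitaryGroup (Fin 2) ℂ))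
          (U₀ : GaugeField (i.1.1.P i.1.2.2) 0 (Matrix.specialUnitaryGroup (Fin 2) ℂ)),
          RegPr i.1.1 i.1.2.1 i.1.2.2 (C₁ * B₃ * ε₁) U₀ → CloseAvg i.1.1 i.1.2.1 i.1.2.2 i.2.2.le (C₁ * ε₁) V U₀ →
          (∃ A₁ : PBond (i.1.1.P i.1.2.2) 0 → Matrix (Fin 2) (Fin 2) ℂ,
              (S i).nMax U₀ A₁ < ε₄ ∧ (S i).Sol111 V U₀ A₁ ∧ (S i).nMax U₀ A₁ < 3 * B₀ * C₁ * B₃ * ε₁ ∧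
              ∀ A₁' : PBond (i.1.1.P i.1.2.2) 0 → Matrix (Fin 2) (Fin 2) ℂ, (S i).nMax U₀ A₁' < ε₄ → (S i).Sol111 V U₀ A₁' → A₁' = A₁) ∧
          (∀ 𝔄 : PBond (i.1.1.P i.1.2.2) 0 → Matrix (Fin 2) (Fin 2) ℂ, (S i).LikeH1B ε₁ U₀ 𝔄 →
            ∃ A₁ : PBond (i.1.1.P i.1.2.2) 0 → Matrix (Fin 2) (Fin 2) ℂ, (S i).nMax U₀ A₁ < ε₄ ∧ (S i).Sol111G U₀ 𝔄 A₁ ∧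
              ∀ A₁' : PBond (i.1.1.P i.1.2.2) 0 → Matrix (Fin 2) (Fin 2) ℂ, (S i).nMax U₀ A₁' < ε₄ → (S i).Sol111G U₀ 𝔄 A₁' → A₁' = A₁) ∧
          (S i).SolAnalytic U₀ ε₁ ε₄ := by
  constructor
  · rintro ⟨a₄, ha₄, H⟩
    refine ⟨a₄, ha₄, fun i ε₁ ε₄ hε₁ hε₄ h2B V U₀ hreg hclose => ?_⟩
    exact H i ε₁ ε₄ hε₁ hε₄ h2B V U₀ ⟨hreg, hclose⟩
  · rintro ⟨a₄, ha₄, H⟩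
    refine ⟨a₄, ha₄, fun i ε₁ ε₄ hε₁ hε₄ h2B V U₀ h14 => ?_⟩
    obtain ⟨hreg, hclose⟩ := h14
    exact H i ε₁ ε₄ hε₁ hε₄ h2B V U₀ hreg hclose

/-! ## §3 The located existence leaves at the T³ bridge, native -/

section Leaves

variable (F : T3Family) {n K : ℕ} (h : n ≤ K) (S : Resid F n K)

/-- **LEAF `crit112` AT THE T³ BRIDGE, NATIVE** (p. 296 *«This solution determines a critical configuration U₁ by the transformation (112)»* + (123)–(140)
*«satisfying all the conditions (19)–(21) with ε₂ = O(1)C₁B₃ε₁»*): for a (14)-background, a solution `A₁` of (111) with `nMax U₀ A₁ < 3B₀C₁B₃ε₁` has its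
(112)-image «critical in (19)–(21)» and in (19)–(21) with `ε₂ = O₁C₁B₃ε₁` ((19) = `In19`, with some exponent `X`).
[cite: Balaban1985Variational, (112) p.294, p.296 after (122), (123)-(140) pp.296-299] -/
theorem crit112_bridgeFam3_iff {B₀ B₃ C₁ O₁ : ℝ} :
    (∀ (ε₁ : ℝ) (V : (varProblem3 F n K h).Bdry) (U₀ : (lgData3 F n K h S).Cfg) (A₁ : (lgData3 F n K h S).Fld), 0 < ε₁ →
      (lgData3 F n K h S).Sat14 (C₁ * B₃ * ε₁) (C₁ * ε₁) ((bridge3 F n K h S).bdry V) U₀ →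
      (lgData3 F n K h S).Sol111 ((bridge3 F n K h S).bdry V) U₀ A₁ → (lgData3 F n K h S).nMax U₀ A₁ < 3 * B₀ * C₁ * B₃ * ε₁ →
        (lgData3 F n K h S).CritL ((bridge3 F n K h S).bdry V) U₀ ((lgData3 F n K h S).T112 ((bridge3 F n K h S).bdry V) U₀ A₁) ∧
        (lgData3 F n K h S).In19_21 (O₁ * C₁ * B₃ * ε₁) ((bridge3 F n K h S).bdry V) U₀ ((lgData3 F n K h S).T112 ((bridge3 F n K h S).bdry V) U₀ A₁)) ↔
    ∀ (ε₁ : ℝ) (V : GaugeField (F.P n) 0 (Matrix.specialUnitaryGroup (Fin 2) ℂ)) (U₀ : GaugeField (F.P K) 0 (Matrix.specialUnitaryGroup (Fin 2) ℂ))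
      (A₁ : PBond (F.P K) 0 → Matrix (Fin 2) (Fin 2) ℂ), 0 < ε₁ → RegPr F n K (C₁ * B₃ * ε₁) U₀ → CloseAvg F n K h (C₁ * ε₁) V U₀ →
      S.Sol111 V U₀ A₁ → S.nMax U₀ A₁ < 3 * B₀ * C₁ * B₃ * ε₁ →
        S.CritL V U₀ (S.T112 V U₀ A₁) ∧
        ∃ X : PBond (F.P K) 0 → Matrix (Fin 2) (Fin 2) ℂ, In19 F n K (O₁ * C₁ * B₃ * ε₁) U₀ (S.T112 V U₀ A₁) X ∧ S.AvgCond V U₀ X ∧ S.IsLandau U₀ X := by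
  constructor
  · intro H ε₁ V U₀ A₁ hε₁ hreg hclose hsol hA₁
    exact H ε₁ V U₀ A₁ hε₁ ⟨hreg, hclose⟩ hsol hA₁
  · intro H ε₁ V U₀ A₁ hε₁ h14 hsol hA₁
    obtain ⟨hreg, hclose⟩ := h14
    exact H ε₁ V U₀ A₁ hε₁ hreg hclose hsol hA₁

/-- **LEAF `axial18` AT THE T³ BRIDGE, NATIVE** (p. 299 *«Now we take the configuration U₁U₀ and we apply to it a gauge transformation u satisfying the conditions
\overline{R₀u}ʲ = 1 on Λ_j, and such that the gauge transformed configuration (U₁U₀)^u satisfies the axial gauge conditions Ax_k(𝔅_k, U₀). Let us define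
U_k = (U₁U₀)^u. Proposition 7 [6] implies that U_k belongs to the space (18) with ε₀ = O(1)C₁B₃ε₁. It is a critical configuration of the functional (5).»*): for a
(14)-background and `U₁` in (19)–(21) at `ε₂` which is «critical in (19)–(21)», some (1.29)-restricted `u` puts `(U₁U₀)^u` (the gauge action on `U₁U₀`) in
`𝔘_k(O₂ε₂)` (`RegPr`), in the fibre of `V`, and critical in reading R2.  NOTE THE BINDER: the conclusion's radius is `O₂·ε₂` for EVERY `ε₂` of the hypothesis
(19) — print's sentence is at `ε₂ = O(1)C₁B₃ε₁` only (module docstring, LOCATED). [cite: Balaban1985Variational, p.299 (before (141)); Balaban1985RegularSpaces, Prop. 7 p.98, (1.29) p.81] -/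
theorem axial18_bridgeFam3_iff {B₃ C₁ O₂ : ℝ} :
    (∀ (ε₁ ε₂ : ℝ) (V : (varProblem3 F n K h).Bdry) (U₀ : (lgData3 F n K h S).Cfg) (U₁ : (lgData3 F n K h S).Pert),
      (lgData3 F n K h S).Sat14 (C₁ * B₃ * ε₁) (C₁ * ε₁) ((bridge3 F n K h S).bdry V) U₀ →
      (lgData3 F n K h S).In19_21 ε₂ ((bridge3 F n K h S).bdry V) U₀ U₁ → (lgData3 F n K h S).CritL ((bridge3 F n K h S).bdry V) U₀ U₁ →
        ∃ u : (lgData3 F n K h S).GT, (lgData3 F n K h S).Restricted U₀ u ∧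
          (varProblem3 F n K h).InU (O₂ * ε₂) ((bridge3 F n K h S).emb U₀ ((lgData3 F n K h S).toAxial U₀ U₁ u)) ∧
          (varProblem3 F n K h).InB V ((bridge3 F n K h S).emb U₀ ((lgData3 F n K h S).toAxial U₀ U₁ u)) ∧
          (varProblem3 F n K h).IsCritical V ((bridge3 F n K h S).emb U₀ ((lgData3 F n K h S).toAxial U₀ U₁ u))) ↔
    ∀ (ε₁ ε₂ : ℝ) (V : GaugeField (F.P n) 0 (Matrix.specialUnitaryGroup (Fin 2) ℂ)) (U₀ U₁ : GaugeField (F.P K) 0 (Matrix.specialUnitaryGroup (Fin 2) ℂ))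
      (X : PBond (F.P K) 0 → Matrix (Fin 2) (Fin 2) ℂ), RegPr F n K (C₁ * B₃ * ε₁) U₀ → CloseAvg F n K h (C₁ * ε₁) V U₀ →
      In19 F n K ε₂ U₀ U₁ X → S.AvgCond V U₀ X → S.IsLandau U₀ X → S.CritL V U₀ U₁ →
        ∃ u : GaugeTransf (F.P K) 0 (Matrix.specialUnitaryGroup (Fin 2) ℂ), S.Restricted U₀ u ∧
          RegPr F n K (O₂ * ε₂) (GaugeField.gaugeAct u (emb15 U₀ U₁)) ∧ GaugeField.gaugeAct u (emb15 U₀ U₁) ∈ fibre F ℰp n K h V ∧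
          IsCritR2 F n K h V (GaugeField.gaugeAct u (emb15 U₀ U₁)) := by
  constructor
  · intro H ε₁ ε₂ V U₀ U₁ X hreg hclose h19 h20 h21 hcrit
    obtain ⟨u, hu, hInU, hInB, hc⟩ := H ε₁ ε₂ V U₀ U₁ ⟨hreg, hclose⟩ ⟨X, h19, h20, h21⟩ hcrit
    refine ⟨u, hu, ?_, ?_, ?_⟩
    · have e : (bridge3 F n K h S).emb U₀ ((lgData3 F n K h S).toAxial U₀ U₁ u) = GaugeField.gaugeAct u (emb15 U₀ U₁) :=
        bridge3_emb_toAxial U₀ U₁ u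
      exact e ▸ hInU
    · exact (bridge3_emb_toAxial U₀ U₁ u) ▸ hInB
    · exact (bridge3_emb_toAxial U₀ U₁ u) ▸ hc
  · intro H ε₁ ε₂ V U₀ U₁ h14 h1921 hcrit
    obtain ⟨hreg, hclose⟩ := h14
    obtain ⟨X, h19, h20, h21⟩ := h1921
    obtain ⟨u, hu, hInU, hInB, hc⟩ := H ε₁ ε₂ V U₀ U₁ X hreg hclose h19 h20 h21 hcrit
    refine ⟨u, hu, ?_, ?_, ?_⟩
    · show RegPr F n K (O₂ * ε₂) (emb15 U₀ (act16 U₀ u U₁))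
      rw [emb15_act16]; exact hInU
    · show emb15 U₀ (act16 U₀ u U₁) ∈ fibre F ℰp n K h V
      rw [emb15_act16]; exact hInB
    · show IsCritR2 F n K h V (emb15 U₀ (act16 U₀ u U₁))
      rw [emb15_act16]; exact hc

/-- **LEAF `minimal142` AT THE T³ BRIDGE, NATIVE** (p. 299 (141)–(142) *«A second order differential at A′ = 0 is given by the quadratic form above, and it is
positive definite. Hence A′ = 0 is a minimum of the functional (143) and this implies that U_k is a minimal configuration of the functional A(U)»*, capped at
radius `e₅`, p. 301 *«a sufficiently small neighborhood»*): for `e ≤ e₅`, a (14)-background, `U₁` «critical in (19)–(21)», a (1.29)-restricted `u` with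
`(U₁U₀)^u ∈ 𝔘_k(e) ∩ 𝔅_k(V)` critical in reading R2: `(U₁U₀)^u` MINIMISES the Wilson action over print's regular fibre `(6)(e)` of `V`.
[cite: Balaban1985Variational, (141)-(142) p.299, p.301] -/
theorem minimal142_bridgeFam3_iff {B₃ C₁ e₅ : ℝ} :
    (∀ (e ε₁ : ℝ) (V : (varProblem3 F n K h).Bdry) (U₀ : (lgData3 F n K h S).Cfg) (U₁ : (lgData3 F n K h S).Pert) (u : (lgData3 F n K h S).GT), e ≤ e₅ →
      (lgData3 F n K h S).Sat14 (C₁ * B₃ * ε₁) (C₁ * ε₁) ((bridge3 F n K h S).bdry V) U₀ →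
      (lgData3 F n K h S).CritL ((bridge3 F n K h S).bdry V) U₀ U₁ → (lgData3 F n K h S).Restricted U₀ u →
      (varProblem3 F n K h).InU e ((bridge3 F n K h S).emb U₀ ((lgData3 F n K h S).toAxial U₀ U₁ u)) →
      (varProblem3 F n K h).InB V ((bridge3 F n K h S).emb U₀ ((lgData3 F n K h S).toAxial U₀ U₁ u)) →
      (varProblem3 F n K h).IsCritical V ((bridge3 F n K h S).emb U₀ ((lgData3 F n K h S).toAxial U₀ U₁ u)) →
        (varProblem3 F n K h).OnMinimalOrbit e V ((bridge3 F n K h S).emb U₀ ((lgData3 F n K h S).toAxial U₀ U₁ u))) ↔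
    ∀ (e ε₁ : ℝ) (V : GaugeField (F.P n) 0 (Matrix.specialUnitaryGroup (Fin 2) ℂ)) (U₀ U₁ : GaugeField (F.P K) 0 (Matrix.specialUnitaryGroup (Fin 2) ℂ))
      (u : GaugeTransf (F.P K) 0 (Matrix.specialUnitaryGroup (Fin 2) ℂ)), e ≤ e₅ → RegPr F n K (C₁ * B₃ * ε₁) U₀ → CloseAvg F n K h (C₁ * ε₁) V U₀ →
      S.CritL V U₀ U₁ → S.Restricted U₀ u → RegPr F n K e (GaugeField.gaugeAct u (emb15 U₀ U₁)) →
      GaugeField.gaugeAct u (emb15 U₀ U₁) ∈ fibre F ℰp n K h V → IsCritR2 F n K h V (GaugeField.gaugeAct u (emb15 U₀ U₁)) →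
        GaugeField.gaugeAct u (emb15 U₀ U₁) ∈ regFibrePr F n K h e V ∧
        IsMinOn (fun W : GaugeField (F.P K) 0 (Matrix.specialUnitaryGroup (Fin 2) ℂ) => wilsonAction4 W) (regFibrePr F n K h e V)
          (GaugeField.gaugeAct u (emb15 U₀ U₁)) := by
  constructor
  · intro H e ε₁ V U₀ U₁ u he hreg hclose hcrit hu hInU hInB hc
    have E : (bridge3 F n K h S).emb U₀ ((lgData3 F n K h S).toAxial U₀ U₁ u) = GaugeField.gaugeAct u (emb15 U₀ U₁) :=
      bridge3_emb_toAxial U₀ U₁ u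
    have := H e ε₁ V U₀ U₁ u he ⟨hreg, hclose⟩ hcrit hu (E ▸ hInU) (E ▸ hInB) (E ▸ hc)
    exact E ▸ this
  · intro H e ε₁ V U₀ U₁ u he h14 hcrit hu hInU hInB hc
    obtain ⟨hreg, hclose⟩ := h14
    have E : (bridge3 F n K h S).emb U₀ ((lgData3 F n K h S).toAxial U₀ U₁ u) = GaugeField.gaugeAct u (emb15 U₀ U₁) :=
      bridge3_emb_toAxial U₀ U₁ u
    rw [E] at hInU hInB hc ⊢
    exact H e ε₁ V U₀ U₁ u he hreg hclose hcrit hu hInU hInB hc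

end Leaves

/-- **`ExistenceLeavesCap` AT THE T³ BRIDGE FROM THE THREE NATIVE LEAVES** (the form a T³ prover supplies them in).
[cite: Balaban1985Variational, (112) p.294, (123)-(142) pp.296-299] -/
theorem existenceLeavesCap_bridgeFam3_of_native (S : ResidFam L) {B₀ B₃ C₁ O₁ O₂ e₅ : ℝ} (i : Idx L)
    (h112 : ∀ (ε₁ : ℝ) (V : GaugeField (i.1.1.P i.1.2.1) 0 (Matrix.specialUnitaryGroup (Fin 2) ℂ))
      (U₀ : GaugeField (i.1.1.P i.1.2.2) 0 (Matrix.specialUnitaryGroup (Fin 2) ℂ)) (A₁ : PBond (i.1.1.P i.1.2.2) 0 → Matrix (Fin 2) (Fin 2) ℂ), 0 < ε₁ →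
      RegPr i.1.1 i.1.2.1 i.1.2.2 (C₁ * B₃ * ε₁) U₀ → CloseAvg i.1.1 i.1.2.1 i.1.2.2 i.2.2.le (C₁ * ε₁) V U₀ →
      (S i).Sol111 V U₀ A₁ → (S i).nMax U₀ A₁ < 3 * B₀ * C₁ * B₃ * ε₁ →
        (S i).CritL V U₀ ((S i).T112 V U₀ A₁) ∧
        ∃ X : PBond (i.1.1.P i.1.2.2) 0 → Matrix (Fin 2) (Fin 2) ℂ,
          In19 i.1.1 i.1.2.1 i.1.2.2 (O₁ * C₁ * B₃ * ε₁) U₀ ((S i).T112 V U₀ A₁) X ∧ (S i).AvgCond V U₀ X ∧ (S i).IsLandau U₀ X)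
    (h18 : ∀ (ε₁ ε₂ : ℝ) (V : GaugeField (i.1.1.P i.1.2.1) 0 (Matrix.specialUnitaryGroup (Fin 2) ℂ))
      (U₀ U₁ : GaugeField (i.1.1.P i.1.2.2) 0 (Matrix.specialUnitaryGroup (Fin 2) ℂ)) (X : PBond (i.1.1.P i.1.2.2) 0 → Matrix (Fin 2) (Fin 2) ℂ),
      RegPr i.1.1 i.1.2.1 i.1.2.2 (C₁ * B₃ * ε₁) U₀ → CloseAvg i.1.1 i.1.2.1 i.1.2.2 i.2.2.le (C₁ * ε₁) V U₀ →
      In19 i.1.1 i.1.2.1 i.1.2.2 ε₂ U₀ U₁ X → (S i).AvgCond V U₀ X → (S i).IsLandau U₀ X → (S i).CritL V U₀ U₁ →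
        ∃ u : GaugeTransf (i.1.1.P i.1.2.2) 0 (Matrix.specialUnitaryGroup (Fin 2) ℂ), (S i).Restricted U₀ u ∧
          RegPr i.1.1 i.1.2.1 i.1.2.2 (O₂ * ε₂) (GaugeField.gaugeAct u (emb15 U₀ U₁)) ∧
          GaugeField.gaugeAct u (emb15 U₀ U₁) ∈ fibre i.1.1 ℰp i.1.2.1 i.1.2.2 i.2.2.le V ∧
          IsCritR2 i.1.1 i.1.2.1 i.1.2.2 i.2.2.le V (GaugeField.gaugeAct u (emb15 U₀ U₁)))
    (h142 : ∀ (e ε₁ : ℝ) (V : GaugeField (i.1.1.P i.1.2.1) 0 (Matrix.specialUnitaryGroup (Fin 2) ℂ))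
      (U₀ U₁ : GaugeField (i.1.1.P i.1.2.2) 0 (Matrix.specialUnitaryGroup (Fin 2) ℂ)) (u : GaugeTransf (i.1.1.P i.1.2.2) 0 (Matrix.specialUnitaryGroup (Fin 2) ℂ)),
      e ≤ e₅ → RegPr i.1.1 i.1.2.1 i.1.2.2 (C₁ * B₃ * ε₁) U₀ → CloseAvg i.1.1 i.1.2.1 i.1.2.2 i.2.2.le (C₁ * ε₁) V U₀ →
      (S i).CritL V U₀ U₁ → (S i).Restricted U₀ u → RegPr i.1.1 i.1.2.1 i.1.2.2 e (GaugeField.gaugeAct u (emb15 U₀ U₁)) →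
      GaugeField.gaugeAct u (emb15 U₀ U₁) ∈ fibre i.1.1 ℰp i.1.2.1 i.1.2.2 i.2.2.le V →
      IsCritR2 i.1.1 i.1.2.1 i.1.2.2 i.2.2.le V (GaugeField.gaugeAct u (emb15 U₀ U₁)) →
        GaugeField.gaugeAct u (emb15 U₀ U₁) ∈ regFibrePr i.1.1 i.1.2.1 i.1.2.2 i.2.2.le e V ∧
        IsMinOn (fun W : GaugeField (i.1.1.P i.1.2.2) 0 (Matrix.specialUnitaryGroup (Fin 2) ℂ) => wilsonAction4 W)
          (regFibrePr i.1.1 i.1.2.1 i.1.2.2 i.2.2.le e V) (GaugeField.gaugeAct u (emb15 U₀ U₁))) :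
    ExistenceLeavesCap (bridgeFam3 L S i) B₀ B₃ C₁ O₁ O₂ e₅ where
  crit112 := (crit112_bridgeFam3_iff i.1.1 i.2.2.le (S i)).2 h112
  axial18 := (axial18_bridgeFam3_iff i.1.1 i.2.2.le (S i)).2 h18
  minimal142 := (minimal142_bridgeFam3_iff i.1.1 i.2.2.le (S i)).2 h142

/-- **`ExistenceLeavesCap` AT THE T³ BRIDGE UNFOLDED** — the conjunction of the three native leaves. [cite: Balaban1985Variational, (112) p.294, (123)-(142) pp.296-299] -/
theorem existenceLeavesCap_bridgeFam3_iff (S : ResidFam L) {B₀ B₃ C₁ O₁ O₂ e₅ : ℝ} (i : Idx L) :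
    ExistenceLeavesCap (bridgeFam3 L S i) B₀ B₃ C₁ O₁ O₂ e₅ ↔
      (∀ (ε₁ : ℝ) (V : GaugeField (i.1.1.P i.1.2.1) 0 (Matrix.specialUnitaryGroup (Fin 2) ℂ))
        (U₀ : GaugeField (i.1.1.P i.1.2.2) 0 (Matrix.specialUnitaryGroup (Fin 2) ℂ)) (A₁ : PBond (i.1.1.P i.1.2.2) 0 → Matrix (Fin 2) (Fin 2) ℂ), 0 < ε₁ →
        RegPr i.1.1 i.1.2.1 i.1.2.2 (C₁ * B₃ * ε₁) U₀ → CloseAvg i.1.1 i.1.2.1 i.1.2.2 i.2.2.le (C₁ * ε₁) V U₀ →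
        (S i).Sol111 V U₀ A₁ → (S i).nMax U₀ A₁ < 3 * B₀ * C₁ * B₃ * ε₁ →
          (S i).CritL V U₀ ((S i).T112 V U₀ A₁) ∧
          ∃ X : PBond (i.1.1.P i.1.2.2) 0 → Matrix (Fin 2) (Fin 2) ℂ,
            In19 i.1.1 i.1.2.1 i.1.2.2 (O₁ * C₁ * B₃ * ε₁) U₀ ((S i).T112 V U₀ A₁) X ∧ (S i).AvgCond V U₀ X ∧ (S i).IsLandau U₀ X) ∧
      (∀ (ε₁ ε₂ : ℝ) (V : GaugeField (i.1.1.P i.1.2.1) 0 (Matrix.specialUnitaryGroup (Fin 2) ℂ))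
        (U₀ U₁ : GaugeField (i.1.1.P i.1.2.2) 0 (Matrix.specialUnitaryGroup (Fin 2) ℂ)) (X : PBond (i.1.1.P i.1.2.2) 0 → Matrix (Fin 2) (Fin 2) ℂ),
        RegPr i.1.1 i.1.2.1 i.1.2.2 (C₁ * B₃ * ε₁) U₀ → CloseAvg i.1.1 i.1.2.1 i.1.2.2 i.2.2.le (C₁ * ε₁) V U₀ →
        In19 i.1.1 i.1.2.1 i.1.2.2 ε₂ U₀ U₁ X → (S i).AvgCond V U₀ X → (S i).IsLandau U₀ X → (S i).CritL V U₀ U₁ →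
          ∃ u : GaugeTransf (i.1.1.P i.1.2.2) 0 (Matrix.specialUnitaryGroup (Fin 2) ℂ), (S i).Restricted U₀ u ∧
            RegPr i.1.1 i.1.2.1 i.1.2.2 (O₂ * ε₂) (GaugeField.gaugeAct u (emb15 U₀ U₁)) ∧
            GaugeField.gaugeAct u (emb15 U₀ U₁) ∈ fibre i.1.1 ℰp i.1.2.1 i.1.2.2 i.2.2.le V ∧
            IsCritR2 i.1.1 i.1.2.1 i.1.2.2 i.2.2.le V (GaugeField.gaugeAct u (emb15 U₀ U₁))) ∧
      (∀ (e ε₁ : ℝ) (V : GaugeField (i.1.1.P i.1.2.1) 0 (Matrix.specialUnitaryGroup (Fin 2) ℂ))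
        (U₀ U₁ : GaugeField (i.1.1.P i.1.2.2) 0 (Matrix.specialUnitaryGroup (Fin 2) ℂ)) (u : GaugeTransf (i.1.1.P i.1.2.2) 0 (Matrix.specialUnitaryGroup (Fin 2) ℂ)),
        e ≤ e₅ → RegPr i.1.1 i.1.2.1 i.1.2.2 (C₁ * B₃ * ε₁) U₀ → CloseAvg i.1.1 i.1.2.1 i.1.2.2 i.2.2.le (C₁ * ε₁) V U₀ →
        (S i).CritL V U₀ U₁ → (S i).Restricted U₀ u → RegPr i.1.1 i.1.2.1 i.1.2.2 e (GaugeField.gaugeAct u (emb15 U₀ U₁)) →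
        GaugeField.gaugeAct u (emb15 U₀ U₁) ∈ fibre i.1.1 ℰp i.1.2.1 i.1.2.2 i.2.2.le V →
        IsCritR2 i.1.1 i.1.2.1 i.1.2.2 i.2.2.le V (GaugeField.gaugeAct u (emb15 U₀ U₁)) →
          GaugeField.gaugeAct u (emb15 U₀ U₁) ∈ regFibrePr i.1.1 i.1.2.1 i.1.2.2 i.2.2.le e V ∧
          IsMinOn (fun W : GaugeField (i.1.1.P i.1.2.2) 0 (Matrix.specialUnitaryGroup (Fin 2) ℂ) => wilsonAction4 W)
            (regFibrePr i.1.1 i.1.2.1 i.1.2.2 i.2.2.le e V) (GaugeField.gaugeAct u (emb15 U₀ U₁))) := by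
  constructor
  · intro H
    exact ⟨(crit112_bridgeFam3_iff i.1.1 i.2.2.le (S i)).1 H.crit112, (axial18_bridgeFam3_iff i.1.1 i.2.2.le (S i)).1 H.axial18,
      (minimal142_bridgeFam3_iff i.1.1 i.2.2.le (S i)).1 H.minimal142⟩
  · rintro ⟨h112, h18, h142⟩
    exact existenceLeavesCap_bridgeFam3_of_native S i h112 h18 h142

end Summit.QuantumFields.YangMills.Theorems.Prop7PV3CDENative

end
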